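import Summits.CriticalPhenomena.CardyFormulaZ2.Theorems.HalfPlaneOneArmThird.Negative.ParameterPinned

/-!
# `HalfPlaneOneArmThird` (stmt-CriticalPhenomena-5662), negative side IV: the crux event IS the
# half-plane one-arm event to distance `n` (formalisation audit, closed in Lean)

Part IV of the disprover's support files for the crux `HalfPlaneOneArmThird` (see `Basics.lean`).
The crux confines the open path to the half-BOX `[-n, n] × [0, n]`; the textbook half-plane one-arm
event (Smirnov–Werner 2001 §4; Nolin 2008 §4.6) confines it to the half-PLANE and asks it to reach
sup-distance `n`.  On lattice configurations (`ω ⊆ E(ℤ²)`, an almost sure set) the two coincide: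
`armEvt_subset_far` (trivial direction) and `mem_armEvt_of_far` (stop a half-plane path at its first
exit from the open half-box, `exists_prefix_within_edges`); hence `prob_eq_far`:
`P_p[armEvt n] = P_p[0 ↔ B(n-1)ᶜ inside {0 ≤ x₁}]` for `n ≥ 1`.  This closes in Lean the last point
of the statement audit that the route review (c894e0d7) and refuter g41-25 had argued on paper: no
mis-statement hides in the choice of the confining region.
-/

noncomputable section

namespace Summit.CriticalPhenomena.CardyFormulaZ2.Theorems.HalfPlaneOneArmThird.Negative

open MeasureTheory ProbabilityTheory Filter Topology
open Literature.Probability.Percolation Literature.Probability.LatticeModels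

/-! ## Faithfulness: the crux event IS the half-plane one-arm event to distance `n`

The crux confines the open path to the half-BOX `[-n, n] × [0, n]`; the textbook event confines it
to the half-PLANE and asks it to reach sup-distance `n`.  On lattice configurations (`ω ⊆ E(ℤ²)`,
almost sure) the two coincide: stop a half-plane path at its first exit from the open half-box
(`mem_armEvt_of_far`); hence equal probabilities (`prob_eq_far`).  This closes the last point of
the formalisation audit that had only been argued on paper (route review c894e0d7, refuter g41-25). -/

/-- The closed upper half-plane `{0 ≤ x₁}` of `ℤ²`. -/
def uhp : Set (Site 2) := {v | 0 ≤ v 1}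

/-- The half-box lies in the upper half-plane. -/
theorem halfBox_subset_uhp (n : ℕ) : halfBox n ⊆ uhp := fun _ hv => hv.1

/-- A crux arm is a half-plane connection from `0` to a site outside `B(n-1)`. -/
theorem armEvt_subset_far {n : ℕ} (hn : 1 ≤ n) :
    armEvt n ⊆ {ω | ∃ y ∉ box 2 (n - 1), ω ∈ openConnIn uhp 0 y} := by
  rintro ω ⟨y, hy, h⟩
  refine ⟨y, ?_, openConnIn_mono (halfBox_subset_uhp n) 0 y h⟩
  intro hyb
  rw [mem_box] at hyb
  have h0 := hyb 0
  have h1 := hyb 1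
  push_cast [Nat.cast_sub hn] at h0 h1
  omega

/-- **First exit**: on a lattice configuration, a half-plane open connection from `0` to a site
outside `B(n-1)` contains a crux arm — the initial segment up to the first site on the outer
boundary of the half-box. -/
theorem mem_armEvt_of_far {n : ℕ} (hn : 1 ≤ n) {ω : BondConfig (Site 2)}
    (hω : ω ⊆ (zdGraph 2).edgeSet) {y : Site 2} (hy : y ∉ box 2 (n - 1))
    (h : ω ∈ openConnIn uhp 0 y) : ω ∈ armEvt n := by
  classical
  obtain ⟨h0, hyU, hr⟩ := h
  obtain ⟨W⟩ := hr
  set S : Set uhp := {v | -(n : ℤ) < (v : Site 2) 0 ∧ (v : Site 2) 0 < n ∧ (v : Site 2) 1 < n}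
    with hS
  have h0S : (⟨0, h0⟩ : uhp) ∈ S := by
    simp only [hS, Set.mem_setOf_eq, Pi.zero_apply]; omega
  have hy1 : 0 ≤ y 1 := hyU
  have hyS : (⟨y, hyU⟩ : uhp) ∉ S := by
    intro h'
    simp only [hS, Set.mem_setOf_eq] at h'
    apply hy
    rw [mem_box]
    intro i
    fin_cases i <;> push_cast [Nat.cast_sub hn] <;> omega
  obtain ⟨f, g, hf, hg, hadj, W', -, -, hW'⟩ := exists_prefix_within_edges S W h0S hyS
  have hadjO : (openGraph ω).Adj (f : Site 2) (g : Site 2) := by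
    rw [SimpleGraph.induce_adj] at hadj; exact hadj
  have hadj' : (zdGraph 2).Adj (f : Site 2) (g : Site 2) := by
    have := hadjO
    rw [openGraph_adj] at this
    exact hω this.1
  have e0 := zdGraph_adj_apply_le hadj' 0
  have e1 := zdGraph_adj_apply_le hadj' 1
  have hg1 : 0 ≤ (g : Site 2) 1 := g.2
  simp only [hS, Set.mem_setOf_eq, not_and_or, not_lt] at hf hg
  have hgB : (g : Site 2) ∈ halfBox n := by
    simp only [halfBox, Set.mem_setOf_eq]; omega
  have hgt : (g : Site 2) 0 = (n : ℤ) ∨ (g : Site 2) 0 = -(n : ℤ) ∨ (g : Site 2) 1 = (n : ℤ) := by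
    omega
  have hsupp : ∀ x ∈ W'.support, (x : Site 2) ∈ halfBox n := by
    intro x hx
    have := hW' x hx
    simp only [hS, Set.mem_setOf_eq] at this
    simp only [halfBox, Set.mem_setOf_eq]
    exact ⟨x.2, by omega, by omega, by omega⟩
  obtain ⟨hu, hv, hreach⟩ := reachable_induce_of_walk W' hsupp
  have hstep : ((openGraph ω).induce (halfBox n)).Adj ⟨f, hv⟩ ⟨g, hgB⟩ := by
    rw [SimpleGraph.induce_adj]
    exact hadjO
  exact ⟨g, hgt, hu, hgB, hreach.trans hstep.reachable⟩

/-- **The crux probability is the half-plane one-arm probability to distance `n`**: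
`P_p[armEvt n] = P_p[0 ↔ B(n-1)ᶜ inside the upper half-plane]` for `n ≥ 1`. -/
theorem prob_eq_far (p : unitInterval) {n : ℕ} (hn : 1 ≤ n) :
    prob p n = (bondPercolation (zdGraph 2) p).real {ω | ∃ y ∉ box 2 (n - 1), ω ∈ openConnIn uhp 0 y} := by
  refine le_antisymm (measureReal_mono (armEvt_subset_far hn) (measure_ne_top _ _)) ?_
  refine ENNReal.toReal_mono (measure_ne_top _ _) (measure_mono_ae ?_)
  filter_upwards [ae_subset_edgeSet (zdGraph 2) p] with ω hω hfar
  obtain ⟨y, hy, h⟩ := hfar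
  exact mem_armEvt_of_far hn hω hy h

end Summit.CriticalPhenomena.CardyFormulaZ2.Theorems.HalfPlaneOneArmThird.Negative

end
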